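import Summits.Ventures.CertifiedQuantumChemistry.Rows.OneElectronSectorsExact
import Summits.Ventures.CertifiedQuantumChemistry.Rows.TwoElectronSectorsExact
import Literature.MathematicalPhysics.QuantumChemistry.ParticleHoleConjugation
import HarnessLib

/-!
# Ventures/CertifiedQuantumChemistry — Rows/OneHoleSectorsExact.lean: the level-DQG programme is EXACT
# in every ONE-HOLE sector and on the FULL BAND of every symmetric model; hence both rungs of the cell's
# ladder (`DQG`, `DQGT1T2′`) are exact on the three OUTERMOST fillings at each end of the range, and in
# EVERY sector of every model with at most two spatial orbitals

HONEST FRAMING (verbatim): certified bounds for a stated model Hamiltonian in a stated basis; not a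
claim about the real molecule beyond that model.

Seat rdm-B, ROWS courtesy file (theorems only; no `def`, no notation, no instance; zero compute). Gen 38
typed the ends `N = 0` (every model) / `N = 2k` (the ring), gen 39 the one-electron sectors of every
model and the one-HOLE sectors of the RING only. The Literature carries the particle–hole map for
ARBITRARY integral tables — hole tables `h̄ = holeOneBody h g`, `ḡ = holeTwoBody g`, `h̄_nuc =
holeConstant h g h_nuc` and the invariance of the relaxation GAP `E₀(a,b)[h,g] − E_PQG(a,b)[h,g] =
E₀(|Λ|−a,|Λ|−b)[h̄,ḡ] − E_PQG(|Λ|−a,|Λ|−b)[h̄,ḡ]` (`sectorGroundEnergy_sub_pqgSectorEnergy_particleHole`) —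
so the one-hole and full-band statements hold for EVERY symmetric model once the hole tables are known
to be Hermitian data again (§1, a direct check on the printed formulas). Bookkeeping closed: at each end
of `0 ≤ N ≤ 2k` the three outermost fillings are solved exactly by level DQG and, by the squeeze
`E_PQG ≤ E_PQGT1T2′ ≤ E₀`, by the `T`-rung; for `k ≤ 2` that is every sector.

* §1 `OneHole.star_holeOneBody`, `star_holeTwoBody`, `star_holeConstant` (hole tables of Hermitian data
  are Hermitian data), `molecularHamiltonian_hole_isHermitian` (from the tables),
  `molecularHamiltonian_hole_isHermitian_of_isHermitian` (from `Pᴴ Ĥ P = Ĥ_hole`).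
* §2 **`OneHole.pqgSectorEnergy_eq_sectorGroundEnergy_oneHole`** — `E_PQG(a, b) = E₀(Ĥ; a, b)` for
  `a + b + 1 = 2|Λ|`, `a, b ≤ |Λ|`, Hermitian data, ANY two-body table (gap invariance + gen 39's
  one-electron theorem on the hole tables); **`FullBand.pqgSectorEnergy_full`** (`E_PQG(|Λ|, |Λ|) =
  Re h̄_nuc`, no hypothesis), **`FullBand.sectorGroundEnergy_full`** (`E₀(Ĥ; |Λ|, |Λ|) = Re h̄_nuc`),
  `FullBand.pqgSectorEnergy_eq_sectorGroundEnergy_full`.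
* §3 the `T`-rung by squeeze: `pqgT1T2pSectorEnergy_eq_sectorGroundEnergy_of_pqg` (wherever level DQG is
  exact so is `DQGT1T2′`), hence `…_of_add_eq_one`, `…_oneHole`, `…_zero_zero`, `…_full`.
* §4 every symmetric `F : Model k`: **`Model.pqgSectorEnergy_eq_energy_oneHole`** (`a + b + 1 = 2k`),
  **`Model.energy_full`** / `Model.pqgSectorEnergy_full` (`E₀(H_F; k, k) = E_core + 2 Σ_p h_pp +
  Σ_{pr} (2 (pp|rr) − (pr|rp))`), `Model.pqgSectorEnergy_eq_energy_full`,
  **`Model.pqgSectorEnergy_eq_energy_of_outer`** (`a + b ≤ 2` or `2k ≤ a + b + 2`),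
  **`Model.pqgSectorEnergy_eq_energy_of_le_two`** (`k ≤ 2`: EVERY sector), and the `T`-rung twins
  `Model.pqgT1T2pSectorEnergy_eq_energy_of_outer` / `…_of_le_two` (Literature value function on the
  model's cast tables — the tree has no `Model` abbrev for the `T`-rung).
* §5 the TV-H rings: `hubbardRingTV_pqgSectorEnergy_eq_energy_of_outer` (`N ≤ 2` or `N ≥ 2L − 2`),
  `hubbardRingTV_gap_eq_zero_of_outer`, `hubbardRingTV_pqgT1T2pSectorEnergy_eq_energy_of_outer`,
  `hubbardRingTV_halfFilled_outer_iff` (on `L = 2n` the sector `(n, n)` of S-U is outer iff `n ≤ 1` —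
  the conjecture's range `n ≥ 2` is exactly the complement), `…_of_le_two` (`L ≤ 2`, every sector).

READING: statements about VALUES of the abstract programmes on the cell's model objects; nothing here
is a certificate, a row or a value of record; nothing is claimed about `3 ≤ N ≤ 2k − 3`. All PROVED
(0 sorry, standard axioms); no defs, no named facts. References (docstring-only): D. A. Mazziotti, Adv.
Chem. Phys. 134 (2007) ch. 3 §II.E.2 eqs. (53)–(55), §II.E.3 eqs. (60), (66) and after (67); M. B.
Ruskai, J. Math. Phys. 11 (1970) 3218; M. Nakata et al., J. Chem. Phys. 128 (2008) 164113 §II.C. Tree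
(REUSED): `holeOneBody`, `holeTwoBody`, `holeConstant`, `pqgSectorEnergy_particleHole`,
`sectorGroundEnergy_particleHole`, `sectorGroundEnergy_sub_pqgSectorEnergy_particleHole`,
`conjTranspose_particleHole_mul_molecularHamiltonian_mul_particleHole`, `molecularHamiltonian_isHermitian`,
`pqgSectorEnergy_le_pqgT1T2pSectorEnergy`, `pqgT1T2pSectorEnergy_le_sectorGroundEnergy` (Literature);
`OneElectron.pqgSectorEnergy_eq_sectorGroundEnergy_of_add_eq_one`, `Model.pqgSectorEnergy_eq_energy_of_add_eq_one`
(gen 39); `VacuumSector.pqgSectorEnergy_zero_zero` / `sectorGroundEnergy_zero_zero`,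
`Model.pqgSectorEnergy_zero_zero`, `Model.energy_zero_zero` (gen 38);
`Model.pqgSectorEnergy_eq_energy_of_add_eq_two` / `…_twoHole` (gen 39); `hubbardRingTV_isSymmetric`.
Mathlib: `Matrix.isHermitian_conjTranspose_mul_mul`.
-/

noncomputable section

namespace Summit.Ventures.CertifiedQuantumChemistry

open Matrix Finset Literature.MathematicalPhysics.QuantumLattice Literature.MathematicalPhysics.QuantumChemistry
open Summit.Ventures.CertifiedQuantumChemistry.Hamiltonians
open scoped ComplexOrder

/-! ## §1 The hole tables of Hermitian data are Hermitian data -/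

namespace OneHole

section Abstract

variable {Λ : Type*} [LinearOrder Λ] [Fintype Λ]
variable {h : Λ → Λ → ℂ} {g : Λ → Λ → Λ → Λ → ℂ} {hnuc : ℂ}

omit [LinearOrder Λ] in
/-- **The hole one-body table of Hermitian data is Hermitian**: if `star h_pq = h_qp` and
`star g_pqrs = g_qpsr` then `star h̄_pq = h̄_qp` for
`h̄_pq = −h_qp − Σ_r (g_qprr + g_rrqp) + ½ Σ_r (g_qrrp + g_rpqr)` (term by term; the last two summands
trade places). Mazziotti (2007) §II.E.2 eq. (55). [folklore] -/
theorem star_holeOneBody (hh : ∀ p q, star (h p q) = h q p)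
    (hg : ∀ p q r s, star (g p q r s) = g q p s r) (p q : Λ) :
    star (holeOneBody h g p q) = holeOneBody h g q p := by
  have hh' : ∀ p q, (starRingEnd ℂ) (h p q) = h q p := fun p q => by
    have e := hh p q
    rwa [Complex.star_def] at e
  have hg' : ∀ p q r s, (starRingEnd ℂ) (g p q r s) = g q p s r := fun p q r s => by
    have e := hg p q r s
    rwa [Complex.star_def] at e
  have e : ∑ r, (g r q p r + g p r r q) = ∑ r, (g p r r q + g r q p r) :=
    Finset.sum_congr rfl fun r _ => add_comm _ _
  rw [Complex.star_def]
  unfold holeOneBody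
  simp only [map_add, map_sub, map_neg, map_mul, map_sum, map_div₀, map_one, map_ofNat, hh', hg']
  rw [e]

omit [LinearOrder Λ] [Fintype Λ] in
/-- **The hole two-body table of Hermitian data is Hermitian**: `star ḡ_pqrs = ḡ_qpsr` for `ḡ_pqrs = g_qpsr`.
Mazziotti (2007) §II.E.3 eq. (66). [folklore] -/
theorem star_holeTwoBody (hg : ∀ p q r s, star (g p q r s) = g q p s r) (p q r s : Λ) :
    star (holeTwoBody g p q r s) = holeTwoBody g q p s r := by
  simpa only [holeTwoBody_apply] using hg q p s r

omit [LinearOrder Λ] in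
/-- **The hole constant of Hermitian data is real**: `star h̄_nuc = h̄_nuc` for
`h̄_nuc = h_nuc + 2 Σ_p h_pp + Σ_{pr} (2 g_pprr − g_prrp)` (the exchange sum is carried to itself by
`p ↔ r`). Mazziotti (2007) §II.E.3 eq. (66). [folklore] -/
theorem star_holeConstant (hh : ∀ p q, star (h p q) = h q p)
    (hg : ∀ p q r s, star (g p q r s) = g q p s r) (hn : star hnuc = hnuc) :
    star (holeConstant h g hnuc) = holeConstant h g hnuc := by
  have hh' : ∀ p q, (starRingEnd ℂ) (h p q) = h q p := fun p q => by
    have e := hh p q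
    rwa [Complex.star_def] at e
  have hg' : ∀ p q r s, (starRingEnd ℂ) (g p q r s) = g q p s r := fun p q r s => by
    have e := hg p q r s
    rwa [Complex.star_def] at e
  have hn' : (starRingEnd ℂ) hnuc = hnuc := by
    have e := hn
    rwa [Complex.star_def] at e
  have e : ∑ p, ∑ r, (2 * g p p r r - g r p p r) = ∑ p, ∑ r, (2 * g p p r r - g p r r p) := by
    simp only [Finset.sum_sub_distrib]
    rw [Finset.sum_comm (f := fun p r => g r p p r)]
  rw [Complex.star_def]
  unfold holeConstant
  simp only [map_add, map_sub, map_mul, map_sum, map_ofNat, hh', hg', hn']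
  rw [e]

/-- **The hole Hamiltonian of Hermitian data is Hermitian** — from the tables (§1). [folklore] -/
theorem molecularHamiltonian_hole_isHermitian (hh : ∀ p q, star (h p q) = h q p)
    (hg : ∀ p q r s, star (g p q r s) = g q p s r) (hn : star hnuc = hnuc) :
    (molecularHamiltonian (holeOneBody h g) (holeTwoBody g) (holeConstant h g hnuc)).IsHermitian :=
  molecularHamiltonian_isHermitian (star_holeOneBody hh hg) (star_holeTwoBody hg) (star_holeConstant hh hg hn)

variable (h g hnuc) in
/-- **The hole Hamiltonian of a Hermitian Hamiltonian is Hermitian** — from the operator identity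
`Pᴴ Ĥ(h, g, h_nuc) P = Ĥ(h̄, ḡ, h̄_nuc)` of the Literature (no hypothesis on the tables). [folklore] -/
theorem molecularHamiltonian_hole_isHermitian_of_isHermitian (hH : (molecularHamiltonian h g hnuc).IsHermitian) :
    (molecularHamiltonian (holeOneBody h g) (holeTwoBody g) (holeConstant h g hnuc)).IsHermitian := by
  rw [← conjTranspose_particleHole_mul_molecularHamiltonian_mul_particleHole h g hnuc]
  exact Matrix.isHermitian_conjTranspose_mul_mul _ hH

/-! ## §2 The relaxation is exact in every one-hole sector and on the full band -/

/-- **`E_PQG(a, b) = E₀(Ĥ; a, b)` FOR `a + b + 1 = 2|Λ|`** (one HOLE; Hermitian data, ANY two-body table,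
`a, b ≤ |Λ|`): the relaxation gap of `(a, b)` equals that of the hole sector `(|Λ| − a, |Λ| − b)` for the
hole tables (`sectorGroundEnergy_sub_pqgSectorEnergy_particleHole`), a ONE-ELECTRON sector of Hermitian
data (§1), where the gap vanishes (gen 39's `OneElectron.pqgSectorEnergy_eq_sectorGroundEnergy_of_add_eq_one`).
[folklore] -/
theorem pqgSectorEnergy_eq_sectorGroundEnergy_oneHole (hh : ∀ p q, star (h p q) = h q p)
    (hg : ∀ p q r s, star (g p q r s) = g q p s r) (hn : star hnuc = hnuc) {a b : ℕ}
    (hab : a + b + 1 = 2 * Fintype.card Λ) (ha : a ≤ Fintype.card Λ) (hb : b ≤ Fintype.card Λ) :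
    pqgSectorEnergy h g hnuc a b = sectorGroundEnergy (molecularHamiltonian h g hnuc) a b := by
  have hgap := sectorGroundEnergy_sub_pqgSectorEnergy_particleHole h g hnuc ha hb
  have hab' : (Fintype.card Λ - a) + (Fintype.card Λ - b) = 1 := by omega
  have h1 := OneElectron.pqgSectorEnergy_eq_sectorGroundEnergy_of_add_eq_one (holeTwoBody g)
    (star_holeOneBody hh hg) (star_holeConstant hh hg hn) hab' (Nat.sub_le _ _) (Nat.sub_le _ _)
  rw [h1, sub_self, sub_eq_zero] at hgap
  exact hgap.symm

end Abstract

end OneHole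

namespace FullBand

section Abstract

variable {Λ : Type*} [LinearOrder Λ] [Fintype Λ]

/-- **`E_PQG(|Λ|, |Λ|) = Re h̄_nuc`** (the FULL BAND; no hypothesis): the particle–hole image of the vacuum
value `E_PQG(0, 0)[h̄, ḡ, h̄_nuc] = Re h̄_nuc` (gen 38's `VacuumSector.pqgSectorEnergy_zero_zero`). [folklore] -/
theorem pqgSectorEnergy_full (h : Λ → Λ → ℂ) (g : Λ → Λ → Λ → Λ → ℂ) (hnuc : ℂ) :
    pqgSectorEnergy h g hnuc (Fintype.card Λ) (Fintype.card Λ) = (holeConstant h g hnuc).re := by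
  have e := pqgSectorEnergy_particleHole h g hnuc (a := Fintype.card Λ) (b := Fintype.card Λ) le_rfl le_rfl
  rwa [Nat.sub_self, VacuumSector.pqgSectorEnergy_zero_zero] at e

/-- **`E₀(Ĥ; |Λ|, |Λ|) = Re h̄_nuc`** for a Hermitian `Ĥ(h, g, h_nuc)`: the energy of the completely filled
determinant, the particle–hole image of the vacuum energy of the (Hermitian) hole Hamiltonian. [folklore] -/
theorem sectorGroundEnergy_full {h : Λ → Λ → ℂ} {g : Λ → Λ → Λ → Λ → ℂ} {hnuc : ℂ}
    (hH : (molecularHamiltonian h g hnuc).IsHermitian) :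
    sectorGroundEnergy (molecularHamiltonian h g hnuc) (Fintype.card Λ) (Fintype.card Λ) =
      (holeConstant h g hnuc).re := by
  have e := sectorGroundEnergy_particleHole h g hnuc (a := Fintype.card Λ) (b := Fintype.card Λ) le_rfl le_rfl
  rwa [Nat.sub_self, VacuumSector.sectorGroundEnergy_zero_zero
    (OneHole.molecularHamiltonian_hole_isHermitian_of_isHermitian h g hnuc hH)] at e

/-- **`E_PQG(|Λ|, |Λ|) = E₀(Ĥ; |Λ|, |Λ|)`** for a Hermitian `Ĥ`: the relaxation is exact on the full band.
[folklore] -/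
theorem pqgSectorEnergy_eq_sectorGroundEnergy_full {h : Λ → Λ → ℂ} {g : Λ → Λ → Λ → Λ → ℂ} {hnuc : ℂ}
    (hH : (molecularHamiltonian h g hnuc).IsHermitian) :
    pqgSectorEnergy h g hnuc (Fintype.card Λ) (Fintype.card Λ) =
      sectorGroundEnergy (molecularHamiltonian h g hnuc) (Fintype.card Λ) (Fintype.card Λ) := by
  rw [pqgSectorEnergy_full, sectorGroundEnergy_full hH]

end Abstract

end FullBand

/-! ## §3 The `T`-rung by squeeze: `E_PQG ≤ E_PQGT1T2′ ≤ E₀` -/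

namespace OneHole

section Squeeze

variable {Λ : Type*} [LinearOrder Λ] [Fintype Λ]
variable {h : Λ → Λ → ℂ} {g : Λ → Λ → Λ → Λ → ℂ} {hnuc : ℂ}

/-- **Wherever level DQG is exact, so is `DQGT1T2′`**: for Hermitian `Ĥ` and `a, b ≤ |Λ|`,
`E_PQG(a, b) = E₀(Ĥ; a, b)` implies `E_PQGT1T2′(a, b) = E₀(Ĥ; a, b)` (the `T`-value is squeezed between
them, `RelaxationEnergyHierarchy`). Nakata et al. (2008) §II.C. [folklore] -/
theorem pqgT1T2pSectorEnergy_eq_sectorGroundEnergy_of_pqg (hH : (molecularHamiltonian h g hnuc).IsHermitian)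
    {a b : ℕ} (ha : a ≤ Fintype.card Λ) (hb : b ≤ Fintype.card Λ)
    (heq : pqgSectorEnergy h g hnuc a b = sectorGroundEnergy (molecularHamiltonian h g hnuc) a b) :
    pqgT1T2pSectorEnergy h g hnuc a b = sectorGroundEnergy (molecularHamiltonian h g hnuc) a b :=
  le_antisymm (pqgT1T2pSectorEnergy_le_sectorGroundEnergy hH ha hb)
    (heq.symm.le.trans (pqgSectorEnergy_le_pqgT1T2pSectorEnergy h g hnuc ha hb))

/-- **`E_PQGT1T2′(a, b) = E₀(Ĥ; a, b)` for `a + b = 1`** (one electron; Hermitian `h`, real `h_nuc`, any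
`g`). [folklore] -/
theorem pqgT1T2pSectorEnergy_eq_sectorGroundEnergy_of_add_eq_one (hh : ∀ p q, star (h p q) = h q p)
    (hg : ∀ p q r s, star (g p q r s) = g q p s r) (hn : star hnuc = hnuc) {a b : ℕ} (hab : a + b = 1)
    (ha : a ≤ Fintype.card Λ) (hb : b ≤ Fintype.card Λ) :
    pqgT1T2pSectorEnergy h g hnuc a b = sectorGroundEnergy (molecularHamiltonian h g hnuc) a b :=
  pqgT1T2pSectorEnergy_eq_sectorGroundEnergy_of_pqg (molecularHamiltonian_isHermitian hh hg hn) ha hb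
    (OneElectron.pqgSectorEnergy_eq_sectorGroundEnergy_of_add_eq_one g hh hn hab ha hb)

/-- **`E_PQGT1T2′(a, b) = E₀(Ĥ; a, b)` for `a + b + 1 = 2|Λ|`** (one hole; Hermitian data). [folklore] -/
theorem pqgT1T2pSectorEnergy_eq_sectorGroundEnergy_oneHole (hh : ∀ p q, star (h p q) = h q p)
    (hg : ∀ p q r s, star (g p q r s) = g q p s r) (hn : star hnuc = hnuc) {a b : ℕ}
    (hab : a + b + 1 = 2 * Fintype.card Λ) (ha : a ≤ Fintype.card Λ) (hb : b ≤ Fintype.card Λ) :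
    pqgT1T2pSectorEnergy h g hnuc a b = sectorGroundEnergy (molecularHamiltonian h g hnuc) a b :=
  pqgT1T2pSectorEnergy_eq_sectorGroundEnergy_of_pqg (molecularHamiltonian_isHermitian hh hg hn) ha hb
    (pqgSectorEnergy_eq_sectorGroundEnergy_oneHole hh hg hn hab ha hb)

variable (h g hnuc) in
/-- **`E_PQGT1T2′(0, 0) = E₀(Ĥ; 0, 0)`** (`= Re h_nuc`; the vacuum sector, Hermitian `Ĥ`). [folklore] -/
theorem pqgT1T2pSectorEnergy_eq_sectorGroundEnergy_zero_zero (hH : (molecularHamiltonian h g hnuc).IsHermitian) :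
    pqgT1T2pSectorEnergy h g hnuc 0 0 = sectorGroundEnergy (molecularHamiltonian h g hnuc) 0 0 :=
  pqgT1T2pSectorEnergy_eq_sectorGroundEnergy_of_pqg hH (Nat.zero_le _) (Nat.zero_le _)
    (by rw [VacuumSector.pqgSectorEnergy_zero_zero, VacuumSector.sectorGroundEnergy_zero_zero hH])

variable (h g hnuc) in
/-- **`E_PQGT1T2′(|Λ|, |Λ|) = E₀(Ĥ; |Λ|, |Λ|)`** (`= Re h̄_nuc`; the full band, Hermitian `Ĥ`). [folklore] -/
theorem pqgT1T2pSectorEnergy_eq_sectorGroundEnergy_full (hH : (molecularHamiltonian h g hnuc).IsHermitian) :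
    pqgT1T2pSectorEnergy h g hnuc (Fintype.card Λ) (Fintype.card Λ) =
      sectorGroundEnergy (molecularHamiltonian h g hnuc) (Fintype.card Λ) (Fintype.card Λ) :=
  pqgT1T2pSectorEnergy_eq_sectorGroundEnergy_of_pqg hH le_rfl le_rfl
    (FullBand.pqgSectorEnergy_eq_sectorGroundEnergy_full hH)

end Squeeze

end OneHole

/-! ## §4 The cell's objects: every symmetric model -/

namespace Model

variable {k : ℕ} {F : Model k}

/-- **`E_PQG(a, b) = E₀(H_F; a, b)` FOR `a + b + 1 = 2k`** (one HOLE; every symmetric model, `a, b ≤ k`):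
the level-DQG value IS the quantity K1 in every one-hole sector. [folklore] -/
theorem pqgSectorEnergy_eq_energy_oneHole (hF : F.IsSymmetric) {a b : ℕ} (hab : a + b + 1 = 2 * k)
    (ha : a ≤ k) (hb : b ≤ k) : F.pqgSectorEnergy a b = F.energy a b :=
  OneHole.pqgSectorEnergy_eq_sectorGroundEnergy_oneHole
    (fun p q => by rw [Complex.star_def, map_ratCast, hF.1 p q])
    (fun p q r s => by rw [Complex.star_def, map_ratCast, hF.2 p q r s]) (by rw [Complex.star_def, map_ratCast])
    (by rw [Fintype.card_fin]; exact hab) (by rw [Fintype.card_fin]; exact ha) (by rw [Fintype.card_fin]; exact hb)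

/-- The hole constant of a model's cast tables is the cast of the rational closed-shell energy
`E_core + 2 Σ_p h_pp + Σ_{pr} (2 (pp|rr) − (pr|rp))`. -/
theorem holeConstant_cast (F : Model k) :
    holeConstant (fun p q => ((F.h p q : ℚ) : ℂ)) (fun p q r s => ((F.eri p q r s : ℚ) : ℂ))
        ((F.ecore : ℚ) : ℂ) =
      ((F.ecore + 2 * ∑ p, F.h p p + ∑ p, ∑ r, (2 * F.eri p p r r - F.eri p r r p) : ℚ) : ℂ) := by
  unfold holeConstant
  push_cast
  rfl

/-- **THE FULL BAND OF A MODEL**: `E_PQG(H_F; k, k) = E_core + 2 Σ_p h_pp + Σ_{pr} (2 (pp|rr) − (pr|rp))`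
for EVERY model `F` (the closed-shell energy of the completely filled orbital space). [folklore] -/
theorem pqgSectorEnergy_full (F : Model k) :
    F.pqgSectorEnergy k k =
      ((F.ecore + 2 * ∑ p, F.h p p + ∑ p, ∑ r, (2 * F.eri p p r r - F.eri p r r p) : ℚ) : ℝ) := by
  have e := FullBand.pqgSectorEnergy_full (fun p q => ((F.h p q : ℚ) : ℂ))
    (fun p q r s => ((F.eri p q r s : ℚ) : ℂ)) ((F.ecore : ℚ) : ℂ)
  rw [Fintype.card_fin, holeConstant_cast, Complex.ratCast_re] at e
  exact e

/-- **THE FULL BAND OF A SYMMETRIC MODEL**: `E₀(H_F; k, k) = E_core + 2 Σ_p h_pp + Σ_{pr} (2 (pp|rr) − (pr|rp))`.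
[folklore] -/
theorem energy_full (hF : F.IsSymmetric) :
    F.energy k k =
      ((F.ecore + 2 * ∑ p, F.h p p + ∑ p, ∑ r, (2 * F.eri p p r r - F.eri p r r p) : ℚ) : ℝ) := by
  have e := FullBand.sectorGroundEnergy_full (F.hamiltonian_isHermitian hF)
  rw [Fintype.card_fin, holeConstant_cast, Complex.ratCast_re] at e
  exact e

/-- **`E_PQG(H_F; k, k) = E₀(H_F; k, k)`**: the relaxation is exact on the full band of every symmetric
model. [folklore] -/
theorem pqgSectorEnergy_eq_energy_full (hF : F.IsSymmetric) : F.pqgSectorEnergy k k = F.energy k k := by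
  rw [pqgSectorEnergy_full, energy_full hF]

/-- **LEVEL DQG IS EXACT ON THE THREE OUTERMOST FILLINGS AT EACH END**: for every symmetric model,
`a, b ≤ k`, and `N = a + b ∈ {0, 1, 2} ∪ {2k − 2, 2k − 1, 2k}`: `E_PQG(H_F; a, b) = E₀(H_F; a, b)`
(vacuum, one electron, two electrons; two holes, one hole, full band). [folklore] -/
theorem pqgSectorEnergy_eq_energy_of_outer (hF : F.IsSymmetric) {a b : ℕ} (ha : a ≤ k) (hb : b ≤ k)
    (hN : a + b ≤ 2 ∨ 2 * k ≤ a + b + 2) : F.pqgSectorEnergy a b = F.energy a b := by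
  by_cases h0 : a + b = 0
  · obtain ⟨rfl, rfl⟩ : a = 0 ∧ b = 0 := by omega
    rw [Model.pqgSectorEnergy_zero_zero, Model.energy_zero_zero hF]
  by_cases h1 : a + b = 1
  · exact pqgSectorEnergy_eq_energy_of_add_eq_one hF h1 ha hb
  by_cases h2 : a + b = 2
  · exact pqgSectorEnergy_eq_energy_of_add_eq_two hF h2 ha hb
  by_cases h3 : a + b + 2 = 2 * k
  · exact pqgSectorEnergy_eq_energy_twoHole hF h3 ha hb
  by_cases h4 : a + b + 1 = 2 * k
  · exact pqgSectorEnergy_eq_energy_oneHole hF h4 ha hb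
  · obtain ⟨rfl, rfl⟩ : a = k ∧ b = k := by omega
    exact pqgSectorEnergy_eq_energy_full hF

/-- **`k ≤ 2`: LEVEL DQG IS EXACT IN EVERY SECTOR** of every symmetric model with at most two spatial
orbitals (at most four spin orbitals; every filling is outer). [folklore] -/
theorem pqgSectorEnergy_eq_energy_of_le_two (hF : F.IsSymmetric) (hk : k ≤ 2) {a b : ℕ} (ha : a ≤ k)
    (hb : b ≤ k) : F.pqgSectorEnergy a b = F.energy a b :=
  pqgSectorEnergy_eq_energy_of_outer hF ha hb (by omega)

/-- **THE `T`-RUNG IS EXACT ON THE OUTER FILLINGS TOO**: for every symmetric model, `a, b ≤ k`,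
`N = a + b ∈ {0, 1, 2} ∪ {2k − 2, 2k − 1, 2k}`: `E_PQGT1T2′(H_F; a, b) = E₀(H_F; a, b)` (spelled with the
Literature value function on the model's cast tables). [folklore] -/
theorem pqgT1T2pSectorEnergy_eq_energy_of_outer (hF : F.IsSymmetric) {a b : ℕ} (ha : a ≤ k) (hb : b ≤ k)
    (hN : a + b ≤ 2 ∨ 2 * k ≤ a + b + 2) :
    Literature.MathematicalPhysics.QuantumChemistry.pqgT1T2pSectorEnergy (fun p q => ((F.h p q : ℚ) : ℂ))
        (fun p q r s => ((F.eri p q r s : ℚ) : ℂ)) ((F.ecore : ℚ) : ℂ) a b = F.energy a b :=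
  OneHole.pqgT1T2pSectorEnergy_eq_sectorGroundEnergy_of_pqg (F.hamiltonian_isHermitian hF)
    (by rw [Fintype.card_fin]; exact ha) (by rw [Fintype.card_fin]; exact hb)
    (pqgSectorEnergy_eq_energy_of_outer hF ha hb hN)

/-- **`k ≤ 2`: THE `T`-RUNG IS EXACT IN EVERY SECTOR** of every symmetric model with at most two spatial
orbitals. [folklore] -/
theorem pqgT1T2pSectorEnergy_eq_energy_of_le_two (hF : F.IsSymmetric) (hk : k ≤ 2) {a b : ℕ} (ha : a ≤ k)
    (hb : b ≤ k) :
    Literature.MathematicalPhysics.QuantumChemistry.pqgT1T2pSectorEnergy (fun p q => ((F.h p q : ℚ) : ℂ))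
        (fun p q r s => ((F.eri p q r s : ℚ) : ℂ)) ((F.ecore : ℚ) : ℂ) a b = F.energy a b :=
  pqgT1T2pSectorEnergy_eq_energy_of_outer hF ha hb (by omega)

end Model

/-! ## §5 The TV-H rings: the outer fillings, and where S-U's half-filled sector sits -/

section Ring

variable (L : ℕ) (t U : ℚ)

/-- **On every TV-H ring level DQG is exact on the outer fillings**: `OPT_DQG(L; t, U; a, b) =
E₀(L; t, U; a, b)` whenever `a, b ≤ L` and `a + b ≤ 2` or `a + b ≥ 2L − 2` (every `t, U`). [folklore] -/
theorem hubbardRingTV_pqgSectorEnergy_eq_energy_of_outer {a b : ℕ} (ha : a ≤ L) (hb : b ≤ L)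
    (hN : a + b ≤ 2 ∨ 2 * L ≤ a + b + 2) :
    Model.pqgSectorEnergy (hubbardRingTV L t U) a b = Model.energy (hubbardRingTV L t U) a b :=
  Model.pqgSectorEnergy_eq_energy_of_outer (hubbardRingTV_isSymmetric L t U) ha hb hN

/-- … so the certified gap `E₀ − OPT_DQG` VANISHES on the outer fillings of every ring. [folklore] -/
theorem hubbardRingTV_gap_eq_zero_of_outer {a b : ℕ} (ha : a ≤ L) (hb : b ≤ L)
    (hN : a + b ≤ 2 ∨ 2 * L ≤ a + b + 2) :
    Model.energy (hubbardRingTV L t U) a b - Model.pqgSectorEnergy (hubbardRingTV L t U) a b = 0 := by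
  rw [hubbardRingTV_pqgSectorEnergy_eq_energy_of_outer L t U ha hb hN, sub_self]

/-- **… and so is the `T`-rung**: `OPT_DQGT1T2′(L; t, U; a, b) = E₀(L; t, U; a, b)` on the outer fillings
(the Literature value function on the ring's cast tables). [folklore] -/
theorem hubbardRingTV_pqgT1T2pSectorEnergy_eq_energy_of_outer {a b : ℕ} (ha : a ≤ L) (hb : b ≤ L)
    (hN : a + b ≤ 2 ∨ 2 * L ≤ a + b + 2) :
    Literature.MathematicalPhysics.QuantumChemistry.pqgT1T2pSectorEnergy
        (fun p q => (((hubbardRingTV L t U).h p q : ℚ) : ℂ))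
        (fun p q r s => (((hubbardRingTV L t U).eri p q r s : ℚ) : ℂ))
        (((hubbardRingTV L t U).ecore : ℚ) : ℂ) a b = Model.energy (hubbardRingTV L t U) a b :=
  Model.pqgT1T2pSectorEnergy_eq_energy_of_outer (hubbardRingTV_isSymmetric L t U) ha hb hN

/-- **Where S-U's sector sits**: on the even ring `L = 2n` the half-filled sector `(n, n)` is an outer
filling iff `n ≤ 1` — the conjecture's range `n ≥ 2` is exactly the set of rings on which this file says
nothing. [folklore] -/
theorem hubbardRingTV_halfFilled_outer_iff (n : ℕ) : (n + n ≤ 2 ∨ 2 * (2 * n) ≤ n + n + 2) ↔ n ≤ 1 := by omega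

/-- **The rings with `L ≤ 2`** (the dimer and the one-site "ring"): level DQG is exact in EVERY sector
`a, b ≤ L`, every `t, U` (the `T`-rung too, by `Model.pqgT1T2pSectorEnergy_eq_energy_of_le_two`). [folklore] -/
theorem hubbardRingTV_pqgSectorEnergy_eq_energy_of_le_two (hL : L ≤ 2) {a b : ℕ} (ha : a ≤ L) (hb : b ≤ L) :
    Model.pqgSectorEnergy (hubbardRingTV L t U) a b = Model.energy (hubbardRingTV L t U) a b :=
  Model.pqgSectorEnergy_eq_energy_of_le_two (hubbardRingTV_isSymmetric L t U) hL ha hb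

end Ring

end Summit.Ventures.CertifiedQuantumChemistry

end
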